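import Summits.Ventures.PercRepro.S1ChainRestrict
import Summits.Ventures.PercRepro.S1FourCircuitW2

/-!
# PercRepro — NULLITY BOOKKEEPING FOR THE TRIANGLE COVER (p2, gen 25; SUBCLAIM-S1 §6.9 (x))

Three elementary facts about the nullity `ν(S) = |S| − r(S)` of a subset of a finite matroid, stated in the cell's
spelling `S.encard = M.eRk S + ν`: it exists as a natural number, it is monotone under inclusion, and it drops by
exactly `|S ∖ X|` when `S ⊆ cl X`. Together with the restriction cap `cq3` (S1ChainCq) and the triangle lever
(S1ChainRestrict) they drive the structure theorem of the triangle cover (S1TriangleCoverSeventeen).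

* `exists_nullity` — `∃ ν : ℕ, S.encard = M.eRk S + ν`;
* `nullity_le_of_subset` — `S ⊆ T ⇒ ν(S) ≤ ν(T)`;
* `nullity_of_subset_closure` — `X ⊆ S ⊆ cl X`, `|S ∖ X| = k` ⇒ `ν(X) = ν(S) − k`.
Axioms: standard.
-/

open scoped Matroid

namespace PercRepro

namespace S1

open Set

variable {α : Type}

/-- The nullity of a finite subset, as a natural number. -/
theorem exists_nullity (M : Matroid α) [M.Finite] {S : Set α} (hS : S ⊆ M.E) :
    ∃ ν : ℕ, S.encard = M.eRk S + (ν : ℕ∞) := by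
  have hfin : S.Finite := M.ground_finite.subset hS
  have hr : M.eRk S ≠ ⊤ := ((M.eRk_le_encard S).trans_lt hfin.encard_lt_top).ne
  obtain ⟨r, hr⟩ := ENat.ne_top_iff_exists.1 hr
  obtain ⟨n, hn⟩ := ENat.ne_top_iff_exists.1 hfin.encard_lt_top.ne
  have hle : M.eRk S ≤ S.encard := M.eRk_le_encard S
  rw [← hr, ← hn] at hle
  have hle' : r ≤ n := by exact_mod_cast hle
  refine ⟨n - r, ?_⟩
  rw [← hr, ← hn]
  norm_cast
  omega

/-- **Nullity is monotone**: `S ⊆ T ⊆ E` with `ν(S) = a`, `ν(T) = b` gives `a ≤ b`. -/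
theorem nullity_le_of_subset (M : Matroid α) [M.Finite] {S T : Set α} (hST : S ⊆ T) (hT : T ⊆ M.E)
    {a b : ℕ} (ha : S.encard = M.eRk S + (a : ℕ∞)) (hb : T.encard = M.eRk T + (b : ℕ∞)) : a ≤ b := by
  have hTfin : T.Finite := M.ground_finite.subset hT
  have hSfin : S.Finite := hTfin.subset hST
  have hDfin : (T \ S).Finite := hTfin.subset sdiff_subset
  have h1 : M.eRk T ≤ M.eRk S + M.eRk (T \ S) := M.eRk_le_eRk_add_eRk_sdiff hST
  have h2 : M.eRk (T \ S) ≤ (T \ S).encard := M.eRk_le_encard _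
  have h3 : T.encard = S.encard + (T \ S).encard := by
    rw [← Set.encard_union_eq disjoint_sdiff_right, Set.union_sdiff_cancel hST]
  have hfin : ∀ X ⊆ M.E, M.eRk X ≠ ⊤ := fun X hX =>
    ((M.eRk_le_encard X).trans_lt (M.ground_finite.subset hX).encard_lt_top).ne
  obtain ⟨rS, hrS⟩ := ENat.ne_top_iff_exists.1 (hfin S (hST.trans hT))
  obtain ⟨rT, hrT⟩ := ENat.ne_top_iff_exists.1 (hfin T hT)
  obtain ⟨rD, hrD⟩ := ENat.ne_top_iff_exists.1 (hfin (T \ S) (sdiff_subset.trans hT))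
  obtain ⟨nD, hnD⟩ := ENat.ne_top_iff_exists.1 hDfin.encard_lt_top.ne
  obtain ⟨nS, hnS⟩ := ENat.ne_top_iff_exists.1 hSfin.encard_lt_top.ne
  obtain ⟨nT, hnT⟩ := ENat.ne_top_iff_exists.1 hTfin.encard_lt_top.ne
  rw [← hrS, ← hrT, ← hrD] at h1
  rw [← hrD, ← hnD] at h2
  rw [← hnT, ← hnS, ← hnD] at h3
  rw [← hrS, ← hnS] at ha
  rw [← hrT, ← hnT] at hb
  have h1' : rT ≤ rS + rD := by exact_mod_cast h1
  have h2' : rD ≤ nD := by exact_mod_cast h2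
  have h3' : nT = nS + nD := by exact_mod_cast h3
  have ha' : nS = rS + a := by exact_mod_cast ha
  have hb' : nT = rT + b := by exact_mod_cast hb
  omega

/-- **The nullity drop under closure**: if `X ⊆ S ⊆ cl X` with `ν(S) = d` and `|S ∖ X| = k`, then
`ν(X) = d − k` (the rank does not move, the size drops by `k`). -/
theorem nullity_of_subset_closure (M : Matroid α) [M.Finite] {S X : Set α} (hXS : X ⊆ S) (hS : S ⊆ M.E)
    (hcl : S ⊆ M.closure X) {d : ℕ} (hd : S.encard = M.eRk S + (d : ℕ∞)) {k : ℕ}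
    (hk : (S \ X).encard = k) : X.encard = M.eRk X + ((d - k : ℕ) : ℕ∞) := by
  have hSfin : S.Finite := M.ground_finite.subset hS
  have hXfin : X.Finite := hSfin.subset hXS
  have heq : M.eRk X = M.eRk S := by
    apply le_antisymm (M.eRk_mono hXS)
    calc M.eRk S ≤ M.eRk (M.closure X) := M.eRk_mono hcl
      _ = M.eRk X := M.eRk_closure_eq X
  have h3 : S.encard = X.encard + (S \ X).encard := by
    rw [← Set.encard_union_eq disjoint_sdiff_right, Set.union_sdiff_cancel hXS]
  have hr : M.eRk X ≠ ⊤ := ((M.eRk_le_encard X).trans_lt hXfin.encard_lt_top).ne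
  obtain ⟨r, hr⟩ := ENat.ne_top_iff_exists.1 hr
  obtain ⟨nX, hnX⟩ := ENat.ne_top_iff_exists.1 hXfin.encard_lt_top.ne
  obtain ⟨nS, hnS⟩ := ENat.ne_top_iff_exists.1 hSfin.encard_lt_top.ne
  have hle : M.eRk X ≤ X.encard := M.eRk_le_encard X
  rw [← hr, ← hnX] at hle
  rw [← heq, ← hr, ← hnS] at hd
  rw [← hnS, ← hnX, hk] at h3
  have hle' : r ≤ nX := by exact_mod_cast hle
  have hd' : nS = r + d := by exact_mod_cast hd
  have h3' : nS = nX + k := by exact_mod_cast h3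
  rw [← hr, ← hnX]
  norm_cast
  omega

end S1

end PercRepro
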